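import Literature.MathematicalPhysics.QuantumFieldTheory.Balaban1983to89.B9Eq352ScalarFluct
import Literature.MathematicalPhysics.QuantumFieldTheory.Balaban1983to89.B9Eq373V3Analytic

/-!
# `Balaban1983to89.B9Eq352Analytic` — B9 p. 400 (3.51)–(3.53): «hence F′_{1,k}(iad_{A′(b)}) is an analytic function of A(b)» and
# the analyticity in `A` of `Δ_{U′U}λ` and of the fluctuation operator `V′₁(A)λ`, KERNEL-CHECKED on the exact-background lattice
# carrier of `B9Eq39Adjoint` (the scalar/`G′`-side twin of `B9Eq373V3Analytic`, which does this for `V₃(A)` of (3.82))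

HONEST FRAMING (cell `lit-balaban`, verbatim): statement-level skeleton of published theorems with citation tags; proofs
where landed; nothing here is a claim about the Yang–Mills mass gap.

CITATION HEADER (lean-in-tree rule).  T. Bałaban, *Propagators for lattice gauge theories in a background field*, Commun.
Math. Phys. **99** (1985) 389–434 [`Balaban1985BackgroundPropagators`] (cell paper B9; held `paper:balaban1985-cmp99-background-propagators`,
journal page = PDF page + 388), p. 400 [PDF 12] (3.50)–(3.53) and p. 402 [PDF 14] (the sentence after (3.64)); read by this seat
(r06 gen 22, 2026-08-23) on the render `b2b-balaban-ref1/pages/1985-cmp99-background-propagators/…-p012-x2.png` and in the held text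
layer (p0012, p0014).  Cell `lit-balaban`, seat r06 (B9 fold owner), SKELETON row `B9.Eq3.50` ((3.50)–(3.53)); companion of
`B9Eq352ScalarFluct` (r06 gen 1: `siteLap`, `Fp1`, `V1p`, `eq353`) and of `B9Eq373V3Analytic` (pv27 seat: the analytic toolkit
`CfgAnalyticAt`, `cfgAnalyticAt_prodCfg`, `analyticAt_covD/covDstar`, `analyticAt_exp_comp`, `analyticAt_apply₂` — used BY NAME).

WHAT IS PRINTED («…» verbatim).  p. 400: «… where F′_{1,k}(z) = η⁻²(e^{ηz} − 1 − ηz) = z²∫₀¹dt(1 − t)e^{ηtz}, hence F′_{1,k}(iad_{A′(b)})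
is an analytic function of A(b). Let us denote the first order operator on the right-hand side above by V′₁(A) … (3.52) and
Δ_{U′U} = Δ_U − V′₁(A). (3.53)»; p. 402 (after (3.64)): «Each term in the series is analytic in A on the domain (3.37), and the
series is convergent uniformly, hence G′(U′U) is an analytic function of A also.»

WHAT IS PROVED HERE (kernel-checked; 0 sorry; no definition, no `Prop` fact).
* §1 **`analyticAt_conjRem`**, **`analyticAt_Fp1`**, **`analyticAt_Fp1_letter`** — the printed sentence: the remainder
  `F′_{1,k}(iad_a)Y = η⁻²(e^{iηa}Ye^{−iηa} − Y − iη[a, Y])` (`B9Eq352ScalarFluct.Fp1` = `η⁻²·B9Eq370Expansion.conjRem(iηa, Y)`) is an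
  analytic (entire) function of the letter `a = A(b)` — and of any analytic parametrisation of `(a, Y)` — in every complete normed
  ℂ-algebra (the exponential series; no integral formula needed).
* §2 **`analyticAt_siteLap_cfg`** — the covariant Laplacian `(Δ_𝒱λ)(x)` (3.23)/(3.50) along an analytic family of configurations
  `𝒱(e)`; **`analyticAt_siteLap_prodCfg`** — `A ↦ (Δ_{U′U}λ)(x)`, `U′U = e^{iηA}U`, is analytic along every letterwise-analytic
  parametrisation `e ↦ A(e)`; **`analyticAt_V1p`** — hence so is `A ↦ (V′₁(A)λ)(x)` (by (3.53), `eq353`: `V′₁(A)λ = Δ_Uλ − Δ_{U′U}λ`);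
  on a finite lattice, with the identity parametrisation of the field space: **`analyticOnNhd_siteLap_prodCfg`**,
  **`analyticOnNhd_V1p`** (entire), **`analyticOnNhd_V1p_dom337`** (in particular «on the domain (3.37)», the set
  `B9Eq373V3Analytic.dom337`), `differentiable_V1p`, `continuous_V1p`.
HONEST SCOPE.  Pointwise statements (one site `x`, one argument `λ`), exactly as `B9Eq373V3Analytic` states them for `V₃`; the
operator-norm analyticity of `A ↦ V′(A)` that `B9Eq360Vprime` §9 takes as a hypothesis for «G′(U′U) is an analytic function of A»
follows on a finite lattice from these pointwise statements once a norm on the operator space is fixed — not done here; the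
averaging half `F′_{2,j}(A)` of `V′(A)` (3.58) is p06's `B9Eq358Analytic`.  Nothing is inferred from the manuscript.
-/

namespace Literature.MathematicalPhysics.QuantumFieldTheory.Balaban1983to89.B9Eq352Analytic

open NormedSpace Complex
open Literature.MathematicalPhysics.QuantumFieldTheory.Balaban1983to89
open Literature.MathematicalPhysics.QuantumFieldTheory.Balaban1983to89.Beta.BackgroundVertices (ad)
open Literature.MathematicalPhysics.QuantumFieldTheory.Balaban1983to89.B9Eq39Adjoint (R covD covDstar prodCfg)
open Literature.MathematicalPhysics.QuantumFieldTheory.Balaban1983to89.B9Eq370Expansion (conjRem)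
open Literature.MathematicalPhysics.QuantumFieldTheory.Balaban1983to89.B9Eq352ScalarFluct (siteLap Fp1 V1p eq353)
open Literature.MathematicalPhysics.QuantumFieldTheory.Balaban1983to89.B9Eq373V3Analytic (analyticAt_csmul analyticAt_exp_comp
  CfgAnalyticAt cfgAnalyticAt_const cfgAnalyticAt_prodCfg analyticAt_covD analyticAt_covDstar analyticAt_apply₂ dom337)

/-! ## §1 «hence F′_{1,k}(iad_{A′(b)}) is an analytic function of A(b)» -/

section Remainder

variable {𝔸 : Type*} [NormedRing 𝔸] [NormedAlgebra ℂ 𝔸] [CompleteSpace 𝔸]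
variable {E : Type*} [NormedAddCommGroup E] [NormedSpace ℂ E]

omit [CompleteSpace 𝔸] in
/-- the first-order vertex `e ↦ [b(e), X(e)]` (`ad`) of analytic `b`, `X` is analytic. [folklore] [cite: Balaban1985BackgroundPropagators, (3.51) p.400] -/
theorem analyticAt_ad {b X : E → 𝔸} {e₀ : E} (hb : AnalyticAt ℂ b e₀) (hX : AnalyticAt ℂ X e₀) :
    AnalyticAt ℂ (fun e => ad (b e) (X e)) e₀ := by
  simp only [ad]
  exact (hb.mul hX).sub (hX.mul hb)

/-- **The conjugation remainder is analytic**: `e ↦ 𝓕(b(e), X(e)) = e^{b}Xe^{−b} − X − [b, X]` (`B9Eq370Expansion.conjRem`) along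
analytic `b`, `X` — the exponential series in a complete normed ℂ-algebra. [cite: Balaban1985BackgroundPropagators, (3.51) p.400 («F′_{1,k}(z) = η⁻²(e^{ηz} − 1 − ηz) … is an analytic function»)] -/
theorem analyticAt_conjRem {b X : E → 𝔸} {e₀ : E} (hb : AnalyticAt ℂ b e₀) (hX : AnalyticAt ℂ X e₀) :
    AnalyticAt ℂ (fun e => conjRem (b e) (X e)) e₀ := by
  simp only [conjRem]
  exact ((((analyticAt_exp_comp hb).mul hX).mul (analyticAt_exp_comp hb.neg)).sub hX).sub (analyticAt_ad hb hX)

/-- **`F′_{1,k}(iad_a)Y` IS ANALYTIC along analytic `a`, `Y`**: `B9Eq352ScalarFluct.Fp1 η a Y = η⁻²·𝓕(iηa, Y)`.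
[cite: Balaban1985BackgroundPropagators, (3.51) p.400 («hence F′_{1,k}(iad_{A′(b)}) is an analytic function of A(b)»)] -/
theorem analyticAt_Fp1 (η : ℝ) {a Y : E → 𝔸} {e₀ : E} (ha : AnalyticAt ℂ a e₀) (hY : AnalyticAt ℂ Y e₀) :
    AnalyticAt ℂ (fun e => Fp1 η (a e) (Y e)) e₀ := by
  simp only [Fp1]
  exact analyticAt_csmul _ (analyticAt_conjRem (analyticAt_csmul _ ha) hY)

/-- **THE PRINTED SENTENCE, LITERALLY**: for fixed `Y` (= `R(U_b)λ(b₊)`), the letter map `a ↦ F′_{1,k}(iad_a)Y` is an entire function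
of `a = A(b) ∈ 𝔸` («hence F′_{1,k}(iad_{A′(b)}) is an analytic function of A(b)»; for a negatively oriented bond `A′(b) = R(U_b)A(b)` is a
continuous linear function of `A(b)`, covered by `analyticAt_Fp1` with `a := e ↦ R(U_b)e`, see `analyticAt_Fp1_transported`).
[cite: Balaban1985BackgroundPropagators, (3.51) p.400] -/
theorem analyticAt_Fp1_letter (η : ℝ) (Y a₀ : 𝔸) : AnalyticAt ℂ (fun a : 𝔸 => Fp1 η a Y) a₀ :=
  analyticAt_Fp1 η analyticAt_id analyticAt_const

/-- … and for the transported letter of a negatively oriented bond, `a ↦ F′_{1,k}(iad_{−R(V)⁻¹a})W` (the backward term of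
`B9Eq352ScalarFluct.V1p`: `V = U_μ(y)`, `W = R(U_μ(y))⁻¹λ(y)`, `y = x − e_μ`). [cite: Balaban1985BackgroundPropagators, (3.51) p.400, (3.5) p.391] -/
theorem analyticAt_Fp1_transported (η : ℝ) (V : 𝔸ˣ) (W a₀ : 𝔸) :
    AnalyticAt ℂ (fun a : 𝔸 => Fp1 η (-(R V⁻¹ a)) W) a₀ := by
  refine analyticAt_Fp1 η ?_ analyticAt_const
  have hR : AnalyticAt ℂ (fun a : 𝔸 => R V⁻¹ a) a₀ := by
    simp only [R]
    exact (analyticAt_const.mul analyticAt_id).mul analyticAt_const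
  exact hR.neg

end Remainder

/-! ## §2 `Δ_{U′U}λ` and `V′₁(A)λ` are analytic in `A` -/

section Operators

variable {𝔸 : Type*} [NormedRing 𝔸] [NormedAlgebra ℂ 𝔸] [CompleteSpace 𝔸] {S : Type*} {ι : Type*} [Fintype ι]
variable {E : Type*} [NormedAddCommGroup E] [NormedSpace ℂ E]
variable (T : ι → Equiv.Perm S) (U : ι → S → 𝔸ˣ)

/-- **The covariant Laplacian along an analytic family of configurations**: `e ↦ (Δ_{𝒱(e)}λ)(x) = η⁻²Σ_μ(D¹*_μD¹_μλ)(x)`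
(`B9Eq352ScalarFluct.siteLap`, (3.23)/(3.50)) is analytic at `e₀` when every bond variable `e ↦ 𝒱(e)(b′)` is (`CfgAnalyticAt`); `λ`
fixed. [cite: Balaban1985BackgroundPropagators, (3.50) p.400, (3.23) p.394] -/
theorem analyticAt_siteLap_cfg {𝒱 : E → ι → S → 𝔸ˣ} {e₀ : E} (h : CfgAnalyticAt 𝒱 e₀) (η : ℝ) (lam : S → 𝔸) (x : S) :
    AnalyticAt ℂ (fun e => siteLap T (𝒱 e) η lam x) e₀ := by
  simp only [siteLap]
  refine analyticAt_csmul _ ?_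
  refine Finset.analyticAt_fun_sum _ fun μ _ => ?_
  exact analyticAt_covDstar (T := T) h (F := fun e s => covD T (𝒱 e) μ lam s)
    (fun s => analyticAt_covD (T := T) h (F := fun _ => lam) (fun _ => analyticAt_const) μ s) μ x

/-- **`A ↦ (Δ_{U′U}λ)(x)` IS ANALYTIC** along every letterwise-analytic parametrisation `e ↦ A(e)` of the exponent field
(`U′U = e^{iηA}U` = `B9Eq39Adjoint.prodCfg`, an analytic family by `B9Eq373V3Analytic.cfgAnalyticAt_prodCfg`).
[cite: Balaban1985BackgroundPropagators, (3.50) p.400, p.402 (after (3.64))] -/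
theorem analyticAt_siteLap_prodCfg (η : ℝ) {𝒜 : E → ι → S → 𝔸} {e₀ : E} (h𝒜 : ∀ κ z, AnalyticAt ℂ (fun e => 𝒜 e κ z) e₀)
    (lam : S → 𝔸) (x : S) :
    AnalyticAt ℂ (fun e => siteLap T (prodCfg U η (𝒜 e)) η lam x) e₀ :=
  analyticAt_siteLap_cfg T (cfgAnalyticAt_prodCfg U η h𝒜) η lam x

/-- **`A ↦ (V′₁(A)λ)(x)` IS ANALYTIC** along every letterwise-analytic parametrisation of `A`: by (3.53) (`B9Eq352ScalarFluct.eq353`,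
exact) `V′₁(A)λ = Δ_Uλ − Δ_{U′U}λ`, a constant minus an analytic function. This is the operator-level content of «hence F′_{1,k}(iad_{A′(b)})
is an analytic function of A(b)» and of «Each term in the series is analytic in A» (p. 402) for the scalar part `V′₁` of `V′`.
[cite: Balaban1985BackgroundPropagators, (3.52)–(3.53) p.400, p.402 (after (3.64))] -/
theorem analyticAt_V1p (η : ℝ) {𝒜 : E → ι → S → 𝔸} {e₀ : E} (h𝒜 : ∀ κ z, AnalyticAt ℂ (fun e => 𝒜 e κ z) e₀)
    (lam : S → 𝔸) (x : S) :
    AnalyticAt ℂ (fun e => V1p T U η (𝒜 e) lam x) e₀ := by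
  have h : AnalyticAt ℂ (fun e => siteLap T U η lam x - siteLap T (prodCfg U η (𝒜 e)) η lam x) e₀ :=
    analyticAt_const.sub (analyticAt_siteLap_prodCfg T U η h𝒜 lam x)
  refine h.congr (Filter.Eventually.of_forall fun e => ?_)
  show siteLap T U η lam x - siteLap T (prodCfg U η (𝒜 e)) η lam x = V1p T U η (𝒜 e) lam x
  rw [eq353 T U η (𝒜 e) lam x, sub_sub_cancel]

end Operators

/-! ## §3 On a finite lattice: entire in the field `A`, in particular «on the domain (3.37)» -/

section Finite

variable {𝔸 : Type*} [NormedRing 𝔸] [NormedAlgebra ℂ 𝔸] [CompleteSpace 𝔸] {S : Type*} {ι : Type*} [Fintype ι] [Fintype S]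
variable (T : ι → Equiv.Perm S) (U : ι → S → 𝔸ˣ)

/-- On a finite lattice `A ↦ (Δ_{U′U}λ)(x)` is an entire function on the field space `ι → S → 𝔸` (identity parametrisation; the
letters `A ↦ A(b′)` are continuous linear, `B9Eq373V3Analytic.analyticAt_apply₂`). [cite: Balaban1985BackgroundPropagators, (3.50) p.400] -/
theorem analyticOnNhd_siteLap_prodCfg (η : ℝ) (lam : S → 𝔸) (x : S) :
    AnalyticOnNhd ℂ (fun A : ι → S → 𝔸 => siteLap T (prodCfg U η A) η lam x) Set.univ := fun A₀ _ =>
  analyticAt_siteLap_prodCfg T U η (𝒜 := fun A => A) (fun κ z => analyticAt_apply₂ κ z A₀) lam x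

/-- **On a finite lattice `A ↦ (V′₁(A)λ)(x)` is an entire function** of the exponent field. [cite: Balaban1985BackgroundPropagators, (3.52) p.400, p.402 (after (3.64))] -/
theorem analyticOnNhd_V1p (η : ℝ) (lam : S → 𝔸) (x : S) :
    AnalyticOnNhd ℂ (fun A : ι → S → 𝔸 => V1p T U η A lam x) Set.univ := fun A₀ _ =>
  analyticAt_V1p T U η (𝒜 := fun A => A) (fun κ z => analyticAt_apply₂ κ z A₀) lam x

/-- hence in particular «analytic in A on the domain (3.37)» (the one-scale domain `B9Eq373V3Analytic.dom337`; any subset of the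
field space would do). [cite: Balaban1985BackgroundPropagators, p.402 (after (3.64)), (3.37) p.396] -/
theorem analyticOnNhd_V1p_dom337 [LinearOrder ι] (η α₁ L : ℝ) (j : ℕ) (lam : S → 𝔸) (x : S) :
    AnalyticOnNhd ℂ (fun A : ι → S → 𝔸 => V1p T U η A lam x) (dom337 T U η α₁ L j) :=
  (analyticOnNhd_V1p T U η lam x).mono (Set.subset_univ _)

/-- COROLLARY: `A ↦ (V′₁(A)λ)(x)` is (complex-)differentiable everywhere. [cite: Balaban1985BackgroundPropagators, (3.52) p.400] -/
theorem differentiable_V1p (η : ℝ) (lam : S → 𝔸) (x : S) :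
    Differentiable ℂ (fun A : ι → S → 𝔸 => V1p T U η A lam x) := fun A =>
  (analyticOnNhd_V1p T U η lam x A (Set.mem_univ A)).differentiableAt

/-- COROLLARY: continuity in `A`. [cite: Balaban1985BackgroundPropagators, (3.52) p.400] -/
theorem continuous_V1p (η : ℝ) (lam : S → 𝔸) (x : S) :
    Continuous (fun A : ι → S → 𝔸 => V1p T U η A lam x) :=
  (differentiable_V1p T U η lam x).continuous

end Finite

/-! ## §4 Sanity checks -/

section Examples

variable {𝔸 : Type*} [NormedRing 𝔸] [NormedAlgebra ℂ 𝔸] [CompleteSpace 𝔸] {S : Type*} {ι : Type*} [Fintype ι] [Fintype S]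
variable (T : ι → Equiv.Perm S) (U : ι → S → 𝔸ˣ)

/-- at the flat exponent field `A = 0` the fluctuation operator is analytic (a special case of `analyticOnNhd_V1p`). -/
example (η : ℝ) (lam : S → 𝔸) (x : S) : AnalyticAt ℂ (fun A : ι → S → 𝔸 => V1p T U η A lam x) 0 :=
  analyticOnNhd_V1p T U η lam x 0 (Set.mem_univ _)

/-- along a complex line `t ↦ tB` through the origin, `t ↦ (V′₁(tB)λ)(x)` is analytic at every `t₀` (any lattice, finite or not). -/
example (η : ℝ) (B : ι → S → 𝔸) (lam : S → 𝔸) (x : S) (t₀ : ℂ) :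
    AnalyticAt ℂ (fun t : ℂ => V1p T U η (t • B) lam x) t₀ :=
  analyticAt_V1p T U η (𝒜 := fun t : ℂ => t • B) (fun κ z => by
    have h : AnalyticAt ℂ (fun t : ℂ => t • B κ z) t₀ := analyticAt_id.smul analyticAt_const
    simpa only [Pi.smul_apply] using h) lam x

end Examples

end Literature.MathematicalPhysics.QuantumFieldTheory.Balaban1983to89.B9Eq352Analytic
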